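import Summits.SmoothPoincare4.SmoothPoincare4.Theses.SymplecticOrigami
import Literature.Topology.FourManifolds.RealProjectiveSpaceProofs
import Literature.Topology.FourManifolds.SmoothOrientationReversingProofs
import Literature.Topology.FourManifolds.SmoothOrientationDiffeomorphProofs
import Literature.Topology.FourManifolds.RegularLevelSplitting

/-!
# `OrigamiFoldExistence`: `ℝℙ⁴` is not orientable — the witness of the orientability rung
# (negative-side support, crux stmt-SmoothPoincare4-7844)

The standing disprover's work file `Cruxes/OrigamiFoldExistence/Disproof.lean` (§1.3) records that
**orientability of `M` is load-bearing** for the crux `OrigamiFoldExistence` (route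
`SymplecticOrigami`): the typed fold data force a coorientable fold with the two pieces on opposite
sides, hence `w₁(M) = 0` (paper theorem `FoldDataForcesOrientable`), so the crux strengthened to
all closed connected smooth 4-manifolds (`CruxOverClosedConnected`) fails at `ℝℙ⁴` — provided
`ℝℙ⁴` is not orientable in the tree's sense `Literature.Topology.FourManifolds.IsOrientable`
(`Nonempty (SmoothOrientation (𝓡 4) ℝℙ⁴)`).  That second input was so far a named hypothesis
(`RealProjectiveFourNotOrientable`) of the reduction `crux_false_over_closed_connected_of`; this
file PROVES it, for every real projective space of even positive dimension in the relational sense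
`Literature.Topology.FourManifolds.IsRealProjectiveSpace n X` and for the standard
`Literature.Topology.FourManifolds.RealProjectiveSpace n`:

* `det_eq_neg_one_pow_of_comp_eq` — linear algebra at a fixed point (`A ∘ D = L ∘ A`, `L = -id`
  on `range A`, `A` injective ⇒ `det D = (-1)^{dim}`);
* `det_mfderiv_eq_neg_one_pow_of_coe_eq` — a self-map of `𝕊ⁿ` that is `-id` on the tangent
  hyperplane at a fixed point has Jacobian determinant `(-1)ⁿ` there;
* `not_isOrientable_of_isRealProjectiveSpace` — **`ℝℙⁿ`, `n` even, `n ≠ 0`, is not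
  orientable** (deck transformation argument: the antipodal map would both preserve and reverse
  the pulled-back orientation of `𝕊ⁿ`);
* `not_isOrientable_realProjectiveSpace`, `not_isOrientable_realProjectiveFour` — the standard
  `ℝℙⁿ` (`n` even, `n ≠ 0`) and `ℝℙ⁴`.

Helper lemmas only (no Theses statement is asserted); refuter seat
`refuter-cdisprove-stmt-SmoothPoincare4-7844-g4-0`, cycle 4.  Literature-grade facts (Hirsch,
*Differential Topology*, Ch. 4 §4; Lee, *Introduction to Smooth Manifolds*, Ch. 15): a librarian
may relocate them next to `RealProjectiveSpaceProofs.lean`.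
-/

noncomputable section

-- the prescribed namespace `Summit.<P>.<Sub>.…` duplicates `SmoothPoincare4` (P = Sub)
set_option linter.dupNamespace false

open scoped Manifold ContDiff Topology
open Set Function Module Metric InnerProductSpace
open Literature.Topology.FourManifolds

namespace Summit.SmoothPoincare4.SmoothPoincare4.Theorems.OrigamiFoldExistence.Negative

/-- **Linear algebra at a fixed point of a map acting as `-id` on the tangent range**: if `A` is
injective, `A ∘ D = L ∘ A` and `L = -id` on `range A`, then `D = -id`, so `det D = (-1)^{dim F}`
(companion of the tree's `det_eq_neg_one_of_comp_eq_reflection_comp`). [folklore] -/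
theorem det_eq_neg_one_pow_of_comp_eq {F E' : Type*} [AddCommGroup F] [Module ℝ F]
    [AddCommGroup E'] [Module ℝ E'] (A : F →ₗ[ℝ] E') (hA : Injective A) (L : E' →ₗ[ℝ] E')
    (D : F →ₗ[ℝ] F) (hL : ∀ v, L (A v) = -A v) (h : A ∘ₗ D = L ∘ₗ A) :
    LinearMap.det D = (-1) ^ finrank ℝ F := by
  have hD : D = (-1 : ℝ) • LinearMap.id := by
    ext v
    have h1 : A (D v) = L (A v) := LinearMap.congr_fun h v
    rw [hL] at h1
    have h2 : A (D v + v) = 0 := by rw [map_add, h1, neg_add_cancel]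
    have h3 : D v + v = 0 := hA (by rw [h2, map_zero])
    simp [eq_neg_of_add_eq_zero_left h3]
  rw [hD, LinearMap.det_smul, LinearMap.det_id, mul_one]

/-- **A self-map of `𝕊ⁿ` that is `-id` on the tangent hyperplane at a fixed point has Jacobian
`(-1)ⁿ` there.**  Let `r : 𝕊ⁿ → 𝕊ⁿ` lie over a continuous linear map `L` of `ℝⁿ⁺¹` with `r x₁ = x₁`
and `L v = -v` for `v ⊥ x₁`; by the chain rule applied to `val ∘ r = L ∘ val`, `mfderiv r x₁` is
conjugate through the injective `mfderiv val x₁` (range `x₁ᗮ`, Mathlib `range_mfderiv_coe_sphere`)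
to `-id`, so its determinant is `(-1)ⁿ` (same pattern as the tree's
`det_mfderiv_eq_neg_one_of_coe_eq_reflection`; Hirsch, *Differential Topology*, Ch. 4 §4).
[cite: HirschDT1976, Ch. 4 §4, pp. 105–106] -/
theorem det_mfderiv_eq_neg_one_pow_of_coe_eq {n : ℕ}
    {r : sphere (0 : EuclideanSpace ℝ (Fin (n + 1))) 1 →
      sphere (0 : EuclideanSpace ℝ (Fin (n + 1))) 1}
    (L : EuclideanSpace ℝ (Fin (n + 1)) →L[ℝ] EuclideanSpace ℝ (Fin (n + 1)))
    (hr : ∀ x, (r x : EuclideanSpace ℝ (Fin (n + 1))) = L x)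
    {x₁ : sphere (0 : EuclideanSpace ℝ (Fin (n + 1))) 1} (hfix : r x₁ = x₁)
    (hL : ∀ v : EuclideanSpace ℝ (Fin (n + 1)),
      v ∈ (ℝ ∙ (x₁ : EuclideanSpace ℝ (Fin (n + 1))))ᗮ → L v = -v)
    (hrx : MDifferentiableAt (𝓡 n) (𝓡 n) r x₁) :
    LinearMap.det (M := EuclideanSpace ℝ (Fin n))
      (mfderiv (𝓡 n) (𝓡 n) r x₁).toLinearMap = (-1) ^ n := by
  haveI : Fact (finrank ℝ (EuclideanSpace ℝ (Fin (n + 1))) = n + 1) :=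
    ⟨finrank_euclideanSpace_fin⟩
  have hval : ContMDiff (𝓡 n) 𝓘(ℝ, EuclideanSpace ℝ (Fin (n + 1))) 1
      (Subtype.val : sphere (0 : EuclideanSpace ℝ (Fin (n + 1))) 1 →
        EuclideanSpace ℝ (Fin (n + 1))) :=
    contMDiff_coe_sphere
  have hvalx : HasMFDerivAt (𝓡 n) 𝓘(ℝ, EuclideanSpace ℝ (Fin (n + 1)))
      (Subtype.val : sphere (0 : EuclideanSpace ℝ (Fin (n + 1))) 1 →
        EuclideanSpace ℝ (Fin (n + 1))) x₁
      (mfderiv (𝓡 n) 𝓘(ℝ, EuclideanSpace ℝ (Fin (n + 1)))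
        (Subtype.val : sphere (0 : EuclideanSpace ℝ (Fin (n + 1))) 1 →
          EuclideanSpace ℝ (Fin (n + 1))) x₁) :=
    (hval.mdifferentiableAt one_ne_zero).hasMFDerivAt
  have hvalrx : HasMFDerivAt (𝓡 n) 𝓘(ℝ, EuclideanSpace ℝ (Fin (n + 1)))
      (Subtype.val : sphere (0 : EuclideanSpace ℝ (Fin (n + 1))) 1 →
        EuclideanSpace ℝ (Fin (n + 1))) (r x₁)
      (mfderiv (𝓡 n) 𝓘(ℝ, EuclideanSpace ℝ (Fin (n + 1)))
        (Subtype.val : sphere (0 : EuclideanSpace ℝ (Fin (n + 1))) 1 →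
          EuclideanSpace ℝ (Fin (n + 1))) x₁) := by
    rw [hfix]; exact hvalx
  have hrx' : HasMFDerivAt (𝓡 n) (𝓡 n) r x₁ (mfderiv (𝓡 n) (𝓡 n) r x₁) := hrx.hasMFDerivAt
  have h1 : HasMFDerivAt (𝓡 n) 𝓘(ℝ, EuclideanSpace ℝ (Fin (n + 1))) (Subtype.val ∘ r) x₁
      ((mfderiv (𝓡 n) 𝓘(ℝ, EuclideanSpace ℝ (Fin (n + 1)))
        (Subtype.val : sphere (0 : EuclideanSpace ℝ (Fin (n + 1))) 1 →
          EuclideanSpace ℝ (Fin (n + 1))) x₁).comp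
        (mfderiv (𝓡 n) (𝓡 n) r x₁)) :=
    hvalrx.comp x₁ hrx'
  have h2 : HasMFDerivAt (𝓡 n) 𝓘(ℝ, EuclideanSpace ℝ (Fin (n + 1)))
      (L ∘ (Subtype.val : sphere (0 : EuclideanSpace ℝ (Fin (n + 1))) 1 →
        EuclideanSpace ℝ (Fin (n + 1)))) x₁
      (L.comp
        (mfderiv (𝓡 n) 𝓘(ℝ, EuclideanSpace ℝ (Fin (n + 1)))
          (Subtype.val : sphere (0 : EuclideanSpace ℝ (Fin (n + 1))) 1 →
            EuclideanSpace ℝ (Fin (n + 1))) x₁)) :=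
    (L.hasFDerivAt.hasMFDerivAt).comp x₁ hvalx
  have h12 : (Subtype.val ∘ r : sphere (0 : EuclideanSpace ℝ (Fin (n + 1))) 1 →
      EuclideanSpace ℝ (Fin (n + 1))) =
      L ∘ (Subtype.val : sphere (0 : EuclideanSpace ℝ (Fin (n + 1))) 1 →
        EuclideanSpace ℝ (Fin (n + 1))) :=
    funext hr
  rw [h12] at h1
  have hAD := congrArg ContinuousLinearMap.toLinearMap (hasMFDerivAt_unique h1 h2)
  simp only [ContinuousLinearMap.toLinearMap_comp] at hAD
  have hrange : ∀ v, ((mfderiv (𝓡 n) 𝓘(ℝ, EuclideanSpace ℝ (Fin (n + 1)))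
      (Subtype.val : sphere (0 : EuclideanSpace ℝ (Fin (n + 1))) 1 →
        EuclideanSpace ℝ (Fin (n + 1))) x₁) v : EuclideanSpace ℝ (Fin (n + 1))) ∈
      (ℝ ∙ (x₁ : EuclideanSpace ℝ (Fin (n + 1))))ᗮ := by
    intro v
    rw [← range_mfderiv_coe_sphere (n := n) x₁]
    exact ⟨v, rfl⟩
  have key := det_eq_neg_one_pow_of_comp_eq _ (mfderiv_coe_sphere_injective (n := n) x₁)
    (L : EuclideanSpace ℝ (Fin (n + 1)) →ₗ[ℝ] EuclideanSpace ℝ (Fin (n + 1))) _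
    (fun v => hL _ (hrange v)) hAD
  have hfin : finrank ℝ (TangentSpace (𝓡 n) x₁) = n := finrank_euclideanSpace_fin
  rw [hfin] at key
  exact key


/-- **A real projective space of even positive dimension is not orientable** (Hirsch,
*Differential Topology*, Ch. 4 §4, Ex.; Lee, *Introduction to Smooth Manifolds*, Ex. 15.13 /
Prob. 15-3: `ℝℙⁿ` is orientable iff `n` is odd — here the "only if" half for even `n ≥ 2`).
Proof (deck transformation argument, in the tree's `SmoothOrientation` language): let
`q : 𝕊ⁿ → X` be the `C^∞` local diffeomorphism identifying antipodes and suppose `o` orients `X`.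
(1) Pull `o` back along `q` by the sign of the Jacobian (`SmoothOrientation.comapOfDetNeZero`):
an orientation `õ` of `𝕊ⁿ`.  (2) The antipodal diffeomorphism `a` satisfies `q ∘ a = q`, so by
the chain rule `det dq_x = det dq_{a x} · det da_x`, and reading `õ` at `x` and `a x` off the signs
shows that `a` PRESERVES `õ`.  (3) But `a` REVERSES `õ`: `a = ρ ∘ β` with `ρ` the reflection in
the hyperplane `e₀ᗮ`, which reverses every orientation of `𝕊ⁿ` (decided at its fixed point `e₁`,
`det = -1`, exactly as in the tree's `exists_diffeomorph_isOrientationReversing_sphere_holds`), and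
`β = ρ ∘ a : x ↦ (x₀, -x₁, …, -xₙ)`, which preserves every orientation (decided at its fixed point
`e₀`, where `dβ = -id` on `T𝕊ⁿ`, `det = (-1)ⁿ = 1` as `n` is even); both decisions use the
dichotomy `Diffeomorph.isOrientationPreserving_or_isOrientationReversing_holds` on the connected
`𝕊ⁿ` (`n ≥ 1`), and the composite is handled by `IsOrientationPreserving.comp_holds`.
(4) Preserving and reversing at one point contradict "a fibre has exactly two orientations".
[cite: HirschDT1976, Ch. 4 §4; LeeSmoothManifolds2013, Ch. 15] -/
theorem not_isOrientable_of_isRealProjectiveSpace {n : ℕ} (hn : n ≠ 0) (heven : Even n)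
    {X : Type*} [TopologicalSpace X] [ChartedSpace (EuclideanSpace ℝ (Fin n)) X]
    [IsManifold (𝓡 n) ∞ X] (h : IsRealProjectiveSpace n X) : ¬ IsOrientable (𝓡 n) X := by
  rintro ⟨o⟩
  obtain ⟨q, hq, -, hfib⟩ := h
  haveI : Fact (finrank ℝ (EuclideanSpace ℝ (Fin (n + 1))) = n + 1) :=
    ⟨finrank_euclideanSpace_fin⟩
  -- `𝕊ⁿ` is connected (`n ≥ 1`)
  haveI : ConnectedSpace (sphere (0 : EuclideanSpace ℝ (Fin (n + 1))) 1) := by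
    refine isConnected_iff_connectedSpace.mp (isConnected_sphere ?_ 0 zero_le_one)
    rw [← Module.finrank_eq_rank, finrank_euclideanSpace_fin]
    exact_mod_cast Nat.lt_add_of_pos_left (Nat.pos_of_ne_zero hn)
  -- (0) the Jacobian of `q` vanishes nowhere
  have hd0 : ∀ x, LinearMap.det (M := EuclideanSpace ℝ (Fin n))
      (mfderiv (𝓡 n) (𝓡 n) q x).toLinearMap ≠ 0 := by
    intro x
    set A : EuclideanSpace ℝ (Fin n) →ₗ[ℝ] EuclideanSpace ℝ (Fin n) :=
      (mfderiv (𝓡 n) (𝓡 n) q x).toLinearMap with hA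
    have hinj' : Injective (mfderiv (𝓡 n) (𝓡 n) q x) :=
      ((hq x).mfderivToContinuousLinearEquiv (by simp)).injective
    have hinj : Injective A := hinj'
    have hunit : IsUnit A := (LinearMap.isUnit_iff_ker_eq_bot A).2 (LinearMap.ker_eq_bot.2 hinj)
    exact ((LinearMap.isUnit_iff_isUnit_det A).1 hunit).ne_zero
  -- (1) the pulled-back orientation of the sphere
  set õ : SmoothOrientation (𝓡 n) (sphere (0 : EuclideanSpace ℝ (Fin (n + 1))) 1) :=
    o.comapOfDetNeZero q hq.contMDiff (by simp) hd0 with hõ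
  have hõap : ∀ y, õ y = if 0 < LinearMap.det (M := EuclideanSpace ℝ (Fin n))
      (mfderiv (𝓡 n) (𝓡 n) q y).toLinearMap then o (q y) else -o (q y) :=
    fun y => SmoothOrientation.comapOfDetNeZero_apply o q hq.contMDiff (by simp) hd0 y
  -- (2) the antipodal diffeomorphism `a`
  let a : (sphere (0 : EuclideanSpace ℝ (Fin (n + 1))) 1) ≃ₘ⟮𝓡 n, 𝓡 n⟯
      (sphere (0 : EuclideanSpace ℝ (Fin (n + 1))) 1) :=
    { toFun := fun x => -x
      invFun := fun x => -x
      left_inv := fun x => neg_neg x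
      right_inv := fun x => neg_neg x
      contMDiff_toFun := contMDiff_neg_sphere
      contMDiff_invFun := contMDiff_neg_sphere }
  have ha : ∀ x, a x = -x := fun _ => rfl
  have hqa : ∀ x, q (a x) = q x := fun x => by
    rw [ha, hfib]
    exact Or.inr (neg_neg x).symm
  -- (3) `a` PRESERVES `õ` (deck transformation)
  have hpres : IsOrientationPreserving õ õ a := by
    intro x
    have hqd : MDifferentiableAt (𝓡 n) (𝓡 n) q (a x) := hq.contMDiff.mdifferentiableAt (by simp) 
    have had : MDifferentiableAt (𝓡 n) (𝓡 n) a x := a.mdifferentiable (by simp) x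
    have hchain : mfderiv (𝓡 n) (𝓡 n) (q ∘ a) x =
        (mfderiv (𝓡 n) (𝓡 n) q (a x)).comp (mfderiv (𝓡 n) (𝓡 n) a x) :=
      mfderiv_comp x hqd had
    have hfun : (q ∘ a : sphere (0 : EuclideanSpace ℝ (Fin (n + 1))) 1 → X) = q := funext hqa
    rw [hfun] at hchain
    set da := LinearMap.det (M := EuclideanSpace ℝ (Fin n)) (mfderiv (𝓡 n) (𝓡 n) a x).toLinearMap
      with hda
    set b := LinearMap.det (M := EuclideanSpace ℝ (Fin n))
      (mfderiv (𝓡 n) (𝓡 n) q (a x)).toLinearMap with hb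
    set c := LinearMap.det (M := EuclideanSpace ℝ (Fin n)) (mfderiv (𝓡 n) (𝓡 n) q x).toLinearMap
      with hc
    have hcbd : c = b * da := by
      rw [hc, hchain]
      exact LinearMap.det_comp (M := EuclideanSpace ℝ (Fin n))
        (mfderiv (𝓡 n) (𝓡 n) q (a x)).toLinearMap (mfderiv (𝓡 n) (𝓡 n) a x).toLinearMap
    have hb0 : b ≠ 0 := hd0 (a x)
    have hda0 : da ≠ 0 := a.det_mfderiv_ne_zero (by simp) x
    have hsign : 0 < c ↔ (0 < b ↔ 0 < da) := by rw [hcbd]; exact mul_pos_iff_pos_iff_pos hb0 hda0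
    have hO : o (q (a x)) = o (q x) := by rw [hqa]
    rw [hõap (a x), hõap x, hO]
    change (if 0 < b then o (q x) else -o (q x)) = (if 0 < c then o (q x) else -o (q x)) ↔ 0 < da
    have hne : o (q x) ≠ -o (q x) := Module.Ray.ne_neg_self _
    have hne' : -o (q x) ≠ o (q x) := hne.symm
    by_cases hb' : 0 < b <;> by_cases hd' : 0 < da
    · have hc' : 0 < c := hsign.mpr (iff_of_true hb' hd')
      simp [hb', hd', hc']
    · have hc' : ¬ 0 < c := fun h => hd' ((hsign.mp h).mp hb')
      simp [hb', hd', hc', hne]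
    · have hc' : ¬ 0 < c := fun h => hb' ((hsign.mp h).mpr hd')
      simp [hb', hd', hc']
    · have hc' : 0 < c := hsign.mpr (iff_of_false hb' hd')
      simp [hb', hd', hc', hne']
  -- (4) the coordinate reflection `ρ : x ↦ (-x₀, x₁, …)` REVERSES `õ` (Hirsch's example)
  set e₀ : EuclideanSpace ℝ (Fin (n + 1)) := EuclideanSpace.single (0 : Fin (n + 1)) (1 : ℝ)
    with he₀_def
  have he₀ : e₀ ≠ 0 := by simp [he₀_def]
  have he₀S : e₀ ∈ sphere (0 : EuclideanSpace ℝ (Fin (n + 1))) 1 := by simp [he₀_def]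
  set R : EuclideanSpace ℝ (Fin (n + 1)) ≃ₗᵢ[ℝ] EuclideanSpace ℝ (Fin (n + 1)) :=
    ((ℝ ∙ e₀)ᗮ).reflection with hR
  have hRmem : ∀ x : sphere (0 : EuclideanSpace ℝ (Fin (n + 1))) 1,
      R x ∈ sphere (0 : EuclideanSpace ℝ (Fin (n + 1))) 1 := fun x => by
    rw [mem_sphere_zero_iff_norm, LinearIsometryEquiv.norm_map, norm_eq_of_mem_sphere x]
  set r : sphere (0 : EuclideanSpace ℝ (Fin (n + 1))) 1 →
      sphere (0 : EuclideanSpace ℝ (Fin (n + 1))) 1 :=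
    Set.codRestrict (fun x : sphere (0 : EuclideanSpace ℝ (Fin (n + 1))) 1 => R x) _ hRmem
    with hr_def
  have hinv : Function.Involutive r := fun _ =>
    Subtype.ext (Submodule.reflection_reflection _ _)
  have hsmooth : ContMDiff (𝓡 n) (𝓡 n) ∞ r :=
    (R.toContinuousLinearEquiv.contDiff.contMDiff.comp contMDiff_coe_sphere).codRestrict_sphere _
  let ρ : sphere (0 : EuclideanSpace ℝ (Fin (n + 1))) 1 ≃ₘ⟮𝓡 n, 𝓡 n⟯
      sphere (0 : EuclideanSpace ℝ (Fin (n + 1))) 1 :=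
    { toFun := r
      invFun := r
      left_inv := hinv
      right_inv := hinv
      contMDiff_toFun := hsmooth
      contMDiff_invFun := hsmooth }
  have hρ : ∀ x, (ρ x : EuclideanSpace ℝ (Fin (n + 1))) = ((ℝ ∙ e₀)ᗮ).reflection x :=
    fun _ => rfl
  -- the fixed point `e₁ ⊥ e₀` of `ρ` (`n ≠ 0`)
  let x₁ : sphere (0 : EuclideanSpace ℝ (Fin (n + 1))) 1 :=
    ⟨EuclideanSpace.single (1 : Fin (n + 1)) (1 : ℝ), by simp⟩
  have hx₁ : ⟪e₀, (x₁ : EuclideanSpace ℝ (Fin (n + 1)))⟫_ℝ = 0 :=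
    inner_single_zero_single_one n hn
  have hρrev : ρ.IsOrientationReversing õ õ := by
    rcases Diffeomorph.isOrientationPreserving_or_isOrientationReversing_holds ρ (by simp) õ õ
      with h | h
    · exfalso
      have h1 : õ (ρ x₁) = õ x₁ := by rw [eq_self_of_coe_eq_reflection hρ hx₁]
      have h2 := (h x₁).mp h1
      rw [det_mfderiv_eq_neg_one_of_coe_eq_reflection he₀ hρ hx₁
        (ρ.mdifferentiable (by simp) x₁)] at h2
      norm_num at h2
    · exact h
  -- (5) `β := ρ ∘ a` (`x ↦ (x₀, -x₁, …, -xₙ)`) PRESERVES `õ`: fixed point `e₀`, `dβ = -id`, `n` even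
  let β := a.trans ρ
  have hβ : ∀ x, (β x : EuclideanSpace ℝ (Fin (n + 1))) =
      ((-(R.toContinuousLinearEquiv : EuclideanSpace ℝ (Fin (n + 1)) →L[ℝ]
        EuclideanSpace ℝ (Fin (n + 1)))) : EuclideanSpace ℝ (Fin (n + 1)) →L[ℝ]
          EuclideanSpace ℝ (Fin (n + 1))) x := by
    intro x
    change (R ((-x : sphere (0 : EuclideanSpace ℝ (Fin (n + 1))) 1) :
      EuclideanSpace ℝ (Fin (n + 1)))) = -(R x)
    rw [coe_neg_sphere, map_neg]
  let x₀ : sphere (0 : EuclideanSpace ℝ (Fin (n + 1))) 1 := ⟨e₀, he₀S⟩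
  have hβfix : β x₀ = x₀ := by
    apply Subtype.ext
    rw [hβ]
    change -(R e₀) = e₀
    rw [hR, Submodule.reflection_orthogonalComplement_singleton_eq_neg, neg_neg]
  have hL : ∀ v : EuclideanSpace ℝ (Fin (n + 1)),
      v ∈ (ℝ ∙ (x₀ : EuclideanSpace ℝ (Fin (n + 1))))ᗮ →
        ((-(R.toContinuousLinearEquiv : EuclideanSpace ℝ (Fin (n + 1)) →L[ℝ]
          EuclideanSpace ℝ (Fin (n + 1)))) : EuclideanSpace ℝ (Fin (n + 1)) →L[ℝ]
            EuclideanSpace ℝ (Fin (n + 1))) v = -v := by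
    intro v hv
    change -(R v) = -v
    rw [hR, Submodule.reflection_mem_subspace_eq_self hv]
  have hβdet : LinearMap.det (M := EuclideanSpace ℝ (Fin n))
      (mfderiv (𝓡 n) (𝓡 n) β x₀).toLinearMap = 1 := by
    rw [det_mfderiv_eq_neg_one_pow_of_coe_eq _ hβ hβfix hL (β.mdifferentiable (by simp) x₀)]
    exact Even.neg_one_pow heven
  have hβpres : β.IsOrientationPreserving õ õ := by
    rcases Diffeomorph.isOrientationPreserving_or_isOrientationReversing_holds β (by simp) õ õ
      with h | h
    · exact h
    · exfalso
      have h2 := (h x₀).mpr (by rw [hβdet]; exact one_pos)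
      rw [hβfix] at h2
      exact (Module.Ray.ne_neg_self (õ x₀)) (by simpa using h2.symm)
  -- (6) hence `a = ρ ∘ β` REVERSES `õ`
  have hcomp : IsOrientationPreserving õ (-õ) (ρ ∘ β) :=
    IsOrientationPreserving.comp_holds hρrev hβpres (ρ.mdifferentiable (by simp))
      (β.mdifferentiable (by simp)) (ρ.det_mfderiv_ne_zero (by simp))
      (β.det_mfderiv_ne_zero (by simp))
  have hρβ : (ρ ∘ β : sphere (0 : EuclideanSpace ℝ (Fin (n + 1))) 1 →
      sphere (0 : EuclideanSpace ℝ (Fin (n + 1))) 1) = a := by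
    funext x
    change r (r (a x)) = a x
    exact hinv (a x)
  rw [hρβ] at hcomp
  -- (7) contradiction: `a` both preserves and reverses `õ`
  have h1 := hpres x₀
  have h2 := hcomp x₀
  rw [SmoothOrientation.neg_apply] at h2
  rcases orientation_eq_or_eq_neg (õ x₀) (õ (a x₀)) with h | h
  · have h3 : -õ (a x₀) = õ x₀ := h2.mpr (h1.mp h.symm)
    exact Module.Ray.ne_neg_self (õ (a x₀)) (h.symm.trans h3.symm)
  · have h3 : õ (a x₀) = õ x₀ := h1.mpr (h2.mp h.symm)
    exact Module.Ray.ne_neg_self (õ (a x₀)) (h3.trans h)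


/-- **The standard `ℝℙⁿ = 𝕊ⁿ/±1` is not orientable for even `n ≠ 0`.** [folklore] -/
theorem not_isOrientable_realProjectiveSpace {n : ℕ} (hn : n ≠ 0) (heven : Even n) :
    ¬ IsOrientable (𝓡 n) (RealProjectiveSpace n) :=
  not_isOrientable_of_isRealProjectiveSpace hn heven (isRealProjectiveSpace_realProjectiveSpace n)

/-- **`ℝℙ⁴` is not orientable** — the witness of the orientability rung of the load-bearing
ladder of `OrigamiFoldExistence` (`Disproof.lean` §1.3: `CruxOverClosedConnected` fails at `ℝℙ⁴`
granted the paper theorem `FoldDataForcesOrientable`). [folklore] -/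
theorem not_isOrientable_realProjectiveFour : ¬ IsOrientable (𝓡 4) (RealProjectiveSpace 4) :=
  not_isOrientable_realProjectiveSpace (by norm_num) (by decide)

end Summit.SmoothPoincare4.SmoothPoincare4.Theorems.OrigamiFoldExistence.Negative

end
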